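import Mathlib
import HarnessLib
import Summits.NavierStokesRegularity.NavierStokesRegularity.Theorems.PoloidalWindowDoorLrcModEntireRidgeClass

/-!
# Item `LrcModEntire` (stmt-NavierStokesRegularity-20428), registry twist_split v7 — the (TH)-column reading of the ridge lever at class level (memo `Cruxes/LrcModEntire/T2B-g14.md` §9–§10):
# with the RIDGE LAW (`κ`, `β` constant along the hot arc) the squared twist-jet `(∂_ν∂_z v₂)²` is quasiconvex along the arc

LEAD of item 20428 ns-poloidal-K2-p3 g14 (`--supports stmt-NavierStokesRegularity-20428 --as helper`).  One-step corollary of `…RidgeClass.quasiconvexOn_ridgeCoeff_of_class` (p706706) and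
`…RidgeSecondOrder.quasiconvexOn_sq_of_ridgeLaw` (p705187): the constancy of `κ(s) = −σ∂_ν∂_νv₂(−1,γ(s))` and `β(s) = σ∂_z∂_zv₂(−1,γ(s))` along the arc is taken as a HYPOTHESIS here — in the
(TH) column it is the ridge law `…TwistingTHRidgeLaw.horizLaplacian_two_eq_of_hotPoints` (p707183; `∂_τ∂_τ v₂ = 0` along a critical curve of constant value, and `∂_z²v₂ = −μ₀Δₕv₂` by
`plane_wave_identity`) with the slope function of `…TwistingTHSlopeFunction` (p707431) on the non-flat thread plane (`…TwistingTHNonflatPlane`).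

* `quasiconvexOn_sq_nuZ_of_class` — **`s ↦ α(s)² = (∂_ν∂_z v₂(−1,γ(s)))²` is `QuasiconvexOn ℝ [a₁,a₂]`** along a hot arc of a class profile with a straight tube chart, cold lateral
  boundary, constant `κ > 0` and constant `β` on the arc, and a thin tube.

WHAT THIS IS NOT: not a claim about Navier–Stokes regularity — a necessary condition on the hypothetical (TH) ridge of `stub_T2b` (bears_on LADDER-NS N0, item 20428 / crux 19708; both OPEN,
⟨27893⟩ OPEN).
-/

noncomputable section

-- the summit and its single sub-problem share the name (CONVENTIONS §1), as in every Theorems file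
set_option linter.dupNamespace false

namespace Summit.NavierStokesRegularity.NavierStokesRegularity.Theorems.PoloidalWindowDoorLrcModEntireRidgeTwist

open Set Function Filter Topology Metric
open Literature.Analysis Literature.Analysis.FluidPDE
open Summit.NavierStokesRegularity.NavierStokesRegularity.Theorems.PoloidalWindowDoorLrcModEntireRidgeClass
open Summit.NavierStokesRegularity.NavierStokesRegularity.Theorems.PoloidalWindowDoorLrcModEntireRidgeSecondOrder

variable {C : ℝ} {v : ℝ → EuclideanSpace ℝ (Fin 3) → EuclideanSpace ℝ (Fin 3)}

/-- **THE SQUARED TWIST-JET IS QUASICONVEX ALONG A (TH) HOT ARC.**  See the module docstring. -/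
theorem quasiconvexOn_sq_nuZ_of_class
    (hdec : HasTypeITimeDecay C v) (hcont : ContinuousOn (uncurry v) (Iio (0 : ℝ) ×ˢ univ))
    (hmild : ∀ s t : ℝ, s < t → t < 0 → ∀ x, v t x = UnboundedOperators.heatExtension (v s) (t - s) x - oseenDuhamel 1 s v v t x)
    (hpk : ∀ (s z₀ σ M : ℝ) (K O : Set (EuclideanSpace ℝ (Fin 3))), s < 0 →
      ((σ = 1 ∨ σ = -1) ∧ IsCompact K ∧ K.Nonempty ∧ (∀ y ∈ K, y 2 = z₀ ∧ σ * v s y 2 = M) ∧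
        IsOpen O ∧ K ⊆ O ∧ (∀ y ∈ O, y 2 = z₀ → σ * v s y 2 ≤ M) ∧
        (∀ y ∈ O, y 2 = z₀ → σ * v s y 2 = M → y ∈ K)) → False)
    (hcrit : ∀ y ∈ {y : EuclideanSpace ℝ (Fin 3) | y 2 = 0 ∧ v (-1) y 2 = v (-1) 0 2}, fderiv ℝ (fun x => v (-1) x 2) y = 0)
    {C₂ C₃ : ℝ} (hC₂ : ∀ x, ‖iteratedFDeriv ℝ 2 (v (-1)) x‖ ≤ C₂) (hC₃ : ∀ x, ‖iteratedFDeriv ℝ 3 (v (-1)) x‖ ≤ C₃)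
    {σ : ℝ} (hσ : σ = 1 ∨ σ = -1)
    (e : OpenPartialHomeomorph (ℝ × ℝ) (ℝ × ℝ)) {a₁ a₂ r : ℝ} (ha : a₁ ≤ a₂) (hr : 0 < r) (hsrc : Icc a₁ a₂ ×ˢ Icc (-r) r ⊆ e.source)
    {P : ℝ → ℝ × ℝ → EuclideanSpace ℝ (Fin 3)} (hP : ∀ z₀ q, P z₀ q = WithLp.toLp 2 ![q.1, q.2, z₀])
    {γ ν : ℝ → EuclideanSpace ℝ (Fin 3)}
    (hγν : ∀ s ∈ Icc a₁ a₂, ∀ n z : ℝ, P z (e (s, n)) = γ s + n • ν s + z • EuclideanSpace.single 2 1)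
    (hν : ∀ s ∈ Icc a₁ a₂, ‖ν s‖ ≤ 1)
    (hhot : ∀ s ∈ Icc a₁ a₂, γ s 2 = 0 ∧ v (-1) (γ s) 2 = v (-1) 0 2)
    (hlat0 : ∀ a ∈ Icc a₁ a₂, ∀ n : ℝ, (n = r ∨ n = -r) → σ * v (-1) (P 0 (e (a, n))) 2 < σ * v (-1) 0 2)
    {α : ℝ → ℝ} {κ β : ℝ} (hκ0 : 0 < κ) (hthin : 64 * C₃ * r ≤ κ)
    (hκ : ∀ s ∈ Icc a₁ a₂, κ = -(fderiv ℝ (fderiv ℝ (fun y => σ * v (-1) y 2)) (γ s) (ν s) (ν s)))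
    (hα : ∀ s ∈ Icc a₁ a₂, α s = fderiv ℝ (fderiv ℝ (fun y => σ * v (-1) y 2)) (γ s) (ν s) (EuclideanSpace.single 2 1))
    (hβ : ∀ s ∈ Icc a₁ a₂, β = fderiv ℝ (fderiv ℝ (fun y => σ * v (-1) y 2)) (γ s) (EuclideanSpace.single 2 1) (EuclideanSpace.single 2 1)) :
    QuasiconvexOn ℝ (Icc a₁ a₂) fun s => α s ^ 2 := by
  have hm := quasiconvexOn_ridgeCoeff_of_class hdec hcont hmild hpk hcrit hC₂ hC₃ hσ e ha hr hsrc hP hγν hν hhot hlat0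
    (κ := fun _ => κ) (α := α) (β := fun _ => β) (fun s hs => hκ s hs) hα (fun s hs => hβ s hs) hκ0 (fun _ _ => le_rfl) hthin
  exact quasiconvexOn_sq_of_ridgeLaw (m := fun s => α s ^ 2 / κ + β) hκ0 hm (fun s _ => rfl)

end Summit.NavierStokesRegularity.NavierStokesRegularity.Theorems.PoloidalWindowDoorLrcModEntireRidgeTwist
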